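import Literature.AlgebraicGeometry.Motives.Lefschetz
import HarnessLib

/-!
# Lefschetz operators: existence and uniqueness of Kleiman's `⋆` (proofs)

This file discharges the named fact
`Literature.AlgebraicGeometry.Motives.WeilCohomology.existsUnique_isLefschetzStar` of
`Literature.AlgebraicGeometry.Motives.Lefschetz`: for a Weil cohomology theory `W` with the hard
Lefschetz property, `X` smooth projective of dimension `n` and `η ∈ H²(X)` a hyperplane class,
there is a **unique** graded operator `⋆ : H•(X) → H•(X)` vanishing off total degree `2n` with
`⋆ (Lʲ x) = (-1)^{i(i+1)/2} Lⁿ⁻ⁱ⁻ʲ x` for every primitive `x ∈ Pⁱ(X)` and `i + j ≤ n`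
(Kleiman 1968 §1.4, 1.4.1–1.4.2; Kleiman 1994 §4).

## Proof architecture (the classical linear algebra of hard Lefschetz, Kleiman 1968 §1.4)

Everything is deduced from the bijectivity of `Lⁿ⁻ⁱ : Hⁱ(X) → H²ⁿ⁻ⁱ(X)` (`HasHardLefschetz`)
and the algebra axioms of `W` (associativity, unit, vanishing above degree `2n`); the unit lemmas
`a ∪ 1 = a`, `L⁰ x = x` (`cup_unit_right`, `lefschetzPow_zero_eq_self`) are private copies of the
lemmas `cup_one`, `lefschetzPow_zero_apply` of `WeilCohomologyProofs` (kept private and local so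
that this file depends on `Lefschetz` only):

* `cup_pow_pow`, `lefschetzPow_lefschetzPow` : `ηʳ ∪ ηˢ = ηʳ⁺ˢ`, hence `Lˢ ∘ Lʳ = Lʳ⁺ˢ`.
* `hardLefschetzEquiv` : `Lʳ : Hⁱ ≃ H²ⁿ⁻ⁱ` (`i + r = n`) as a linear equivalence.
* The two-step decomposition `Hᵐ⁺²(X) = Pᵐ⁺²(X) ⊕ L Hᵐ(X)` for `m + 2 ≤ n`: the operator
  `lowerOp : Hᵐ⁺² → Hᵐ`, `y ↦ (Lʳ⁺²)⁻¹ (Lʳ⁺¹ y)` (`m + 2 + r = n`) satisfies `lowerOp (L z) = z`,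
  kills primitive classes, and `y - L (lowerOp y)` is primitive
  (`lowerOp_lefschetzPow_one`, `lowerOp_apply_of_isPrimitive`, `isPrimitive_sub_lowerOp`).
* `signOp` : the operator on `Hᵃ(X)`, `a ≤ n`, acting by Kleiman's sign `(-1)^{i(i+1)/2}` on the
  summand `Lʲ Pⁱ(X)` of the Lefschetz decomposition, *defined* by two-step recursion on `a` through
  the decomposition above, and *shown* to act as stated (`signOp_apply_lefschetzPow`).
* `starOp` : `⋆|_{Hᵃ} = Lⁿ⁻ᵃ ∘ signOp` for `a ≤ n` and `⋆|_{Hᵃ} = signOp ∘ (Lᵃ⁻ⁿ)⁻¹` for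
  `n < a ≤ 2n` (zero off total degree `2n`); it is a `⋆` (`isLefschetzStar_starOp`).
* `lefschetz_induction` : the classes `Lʲ x`, `x ∈ Pⁱ(X)` primitive, `i + 2j = a`, `i + j ≤ n`,
  additively generate `Hᵃ(X)` (the spanning half of the Lefschetz decomposition 1.4.1: two-step
  induction for `a ≤ n`, transport along `Lᵃ⁻ⁿ` for `n < a ≤ 2n`, `Hᵃ = 0` for `a > 2n`), whence
  uniqueness (`isLefschetzStar_unique`) and `existsUnique_isLefschetzStar_holds`.

No new axioms, no new named facts; nothing of `Lefschetz.lean` is restated or modified (the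
companion file `LefschetzProofs` discharges `finrank_primitivePart`). The sign convention is the
one recorded in `PreWeilCohomology.IsLefschetzStar` (any sign depending only on the primitive
degree would do for existence and uniqueness).

## References

* S. Kleiman, *Algebraic cycles and the Weil conjectures*, in: Dix exposés sur la cohomologie des
  schémas (1968), §1.4 (1.4.1, 1.4.2).
* S. Kleiman, *The standard conjectures*, in: Motives (Seattle 1991), Proc. Sympos. Pure Math. 55
  (1994), §4.
-/

universe u v

open CategoryTheory AlgebraicGeometry

noncomputable section

namespace Literature.AlgebraicGeometry.Motives

namespace WeilCohomology

variable {k : Type u} [Field k] {K : Type v} [Field K] [CharZero K] (W : WeilCohomology k K)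
variable {n : ℕ} {X : SchemeOver k}

/-! ## Algebra of the iterated Lefschetz operators -/

/-- `a ∪ 1 = a` on a smooth projective `X` (graded commutativity and `1 ∪ a = a`); private copy of
`WeilCohomology.cup_one` (`WeilCohomologyProofs`). [folklore] -/
private theorem cup_unit_right (hX : IsSmoothProjective n X) {i : ℕ} (h : i + 0 = i) (a : W.obj X i) :
    W.cup h a (W.one X) = a := by
  rw [W.cup_comm hX h (Nat.zero_add i) a (W.one X), W.one_cup hX]
  simp

/-- `L⁰ x = x ∪ 1 = x`; private copy of `WeilCohomology.lefschetzPow_zero_apply`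
(`WeilCohomologyProofs`). [folklore] -/
private theorem lefschetzPow_zero_eq_self (hX : IsSmoothProjective n X) (η : W.obj X 2) {i : ℕ}
    (h : i + 2 * 0 = i) (x : W.obj X i) : W.lefschetzPow X η 0 i i h x = x :=
  W.cup_unit_right hX h x

/-- `ηʳ ∪ ηˢ = ηʳ⁺ˢ` (associativity of the cup product; Kleiman 1968 §1.4). [folklore] -/
theorem cup_pow_pow (hX : IsSmoothProjective n X) (η : W.obj X 2) (r s t : ℕ) (hrs : r + s = t)
    (h : 2 * r + 2 * s = 2 * t) : W.cup h (W.pow X η r) (W.pow X η s) = W.pow X η t := by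
  induction s generalizing t with
  | zero =>
    obtain rfl : t = r := by omega
    exact W.cup_unit_right hX h _
  | succ s ih =>
    obtain rfl : t = (r + s) + 1 := by omega
    rw [PreWeilCohomology.pow_succ, PreWeilCohomology.pow_succ,
      ← ih (r + s) rfl (by omega)]
    exact (W.cup_assoc hX _ _ _ _ _ _ _).symm

/-- `Lˢ (Lʳ x) = Lʳ⁺ˢ x` for the iterated Lefschetz operators of a smooth projective `X`
(Kleiman 1968 §1.4). [folklore] -/
theorem lefschetzPow_lefschetzPow (hX : IsSmoothProjective n X) (η : W.obj X 2)
    {r s t i j m : ℕ} (hrs : r + s = t) (h₁ : i + 2 * r = j) (h₂ : j + 2 * s = m)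
    (h₃ : i + 2 * t = m) (x : W.obj X i) :
    W.lefschetzPow X η s j m h₂ (W.lefschetzPow X η r i j h₁ x) =
      W.lefschetzPow X η t i m h₃ x := by
  simp only [PreWeilCohomology.lefschetzPow, LinearMap.flip_apply]
  rw [W.cup_assoc hX h₁ (show 2 * r + 2 * s = 2 * t by omega) h₂ h₃,
    W.cup_pow_pow hX η r s t hrs]

/-! ## Hard Lefschetz as a linear equivalence -/

variable {η : W.obj X 2}

/-- The hard-Lefschetz isomorphism `Lʳ : Hⁱ(X) ≃ Hʲ(X)`, `i + r = n`, `i + 2r = j`, of a Weil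
cohomology theory with the hard Lefschetz property (Kleiman 1968 §1.4). [cite: Kleiman1968, §1.4] -/
def hardLefschetzEquiv (hL : W.HasHardLefschetz) (hX : IsSmoothProjective n X)
    (hη : W.IsHyperplaneClass X η) (i r j : ℕ) (hr : i + r = n) (h : i + 2 * r = j) :
    W.obj X i ≃ₗ[K] W.obj X j :=
  LinearEquiv.ofBijective (W.lefschetzPow X η r i j h) (hL hX η hη i r j hr h)

/-- `hardLefschetzEquiv` is `Lʳ`. [folklore] -/
@[simp]
theorem hardLefschetzEquiv_apply (hL : W.HasHardLefschetz) (hX : IsSmoothProjective n X)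
    (hη : W.IsHyperplaneClass X η) {i r j : ℕ} (hr : i + r = n) (h : i + 2 * r = j)
    (x : W.obj X i) :
    W.hardLefschetzEquiv hL hX hη i r j hr h x = W.lefschetzPow X η r i j h x :=
  rfl

/-- `(Lʳ)⁻¹ (Lʳ x) = x`. [folklore] -/
@[simp]
theorem hardLefschetzEquiv_symm_apply_lefschetzPow (hL : W.HasHardLefschetz)
    (hX : IsSmoothProjective n X) (hη : W.IsHyperplaneClass X η) {i r j : ℕ} (hr : i + r = n)
    (h : i + 2 * r = j) (x : W.obj X i) :
    (W.hardLefschetzEquiv hL hX hη i r j hr h).symm (W.lefschetzPow X η r i j h x) = x :=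
  (W.hardLefschetzEquiv hL hX hη i r j hr h).symm_apply_apply x

/-- `Lʳ ((Lʳ)⁻¹ y) = y`. [folklore] -/
@[simp]
theorem lefschetzPow_hardLefschetzEquiv_symm (hL : W.HasHardLefschetz)
    (hX : IsSmoothProjective n X) (hη : W.IsHyperplaneClass X η) {i r j : ℕ} (hr : i + r = n)
    (h : i + 2 * r = j) (y : W.obj X j) :
    W.lefschetzPow X η r i j h ((W.hardLefschetzEquiv hL hX hη i r j hr h).symm y) = y :=
  (W.hardLefschetzEquiv hL hX hη i r j hr h).apply_symm_apply y

/-! ## The two-step decomposition `Hᵐ⁺² = Pᵐ⁺² ⊕ L Hᵐ` -/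

/-- For `m + 2 ≤ n` (`m + 2 + r = n`), the operator `Hᵐ⁺²(X) → Hᵐ(X)`, `y ↦ (Lʳ⁺²)⁻¹ (Lʳ⁺¹ y)`,
the projection of `y` to its `L Hᵐ`-component in `Hᵐ⁺² = Pᵐ⁺² ⊕ L Hᵐ` followed by `L⁻¹`
(Kleiman 1968 §1.4, proof of 1.4.1). [cite: Kleiman1968, §1.4 (1.4.1)] -/
def lowerOp (hL : W.HasHardLefschetz) (hX : IsSmoothProjective n X)
    (hη : W.IsHyperplaneClass X η) (m r : ℕ) (hr : m + 2 + r = n) :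
    W.obj X (m + 2) →ₗ[K] W.obj X m :=
  (W.hardLefschetzEquiv hL hX hη m (r + 2) (m + 2 * (r + 2)) (by omega) rfl).symm.toLinearMap ∘ₗ
    W.lefschetzPow X η (r + 1) (m + 2) (m + 2 * (r + 2)) (by omega)

/-- `lowerOp (L z) = z`: `lowerOp` is a retraction of `L : Hᵐ → Hᵐ⁺²`. [folklore] -/
@[simp]
theorem lowerOp_lefschetzPow_one (hL : W.HasHardLefschetz) (hX : IsSmoothProjective n X)
    (hη : W.IsHyperplaneClass X η) {m r : ℕ} (hr : m + 2 + r = n) (h : m + 2 * 1 = m + 2)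
    (z : W.obj X m) :
    W.lowerOp hL hX hη m r hr (W.lefschetzPow X η 1 m (m + 2) h z) = z := by
  simp only [lowerOp, LinearMap.coe_comp, LinearEquiv.coe_coe, Function.comp_apply]
  rw [W.lefschetzPow_lefschetzPow hX η (r := 1) (s := r + 1) (t := r + 2) (i := m) (j := m + 2)
    (m := m + 2 * (r + 2)) (by omega) h (by omega) rfl z]
  exact W.hardLefschetzEquiv_symm_apply_lefschetzPow hL hX hη _ rfl z

/-- `lowerOp` kills the primitive classes `Pᵐ⁺²(X) = ker Lʳ⁺¹`. [folklore] -/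
theorem lowerOp_apply_of_isPrimitive (hL : W.HasHardLefschetz) (hX : IsSmoothProjective n X)
    (hη : W.IsHyperplaneClass X η) {m r : ℕ} (hr : m + 2 + r = n) {x : W.obj X (m + 2)}
    (hx : W.IsPrimitive n η x) : W.lowerOp hL hX hη m r hr x = 0 := by
  simp only [lowerOp, LinearMap.coe_comp, LinearEquiv.coe_coe, Function.comp_apply]
  rw [hx.2 (r + 1) (m + 2 * (r + 2)) (by omega) (by omega), LinearEquiv.map_zero]

/-- `y - L (lowerOp y)` is primitive: the `Pᵐ⁺²`-component of `y ∈ Hᵐ⁺²(X)`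
(Kleiman 1968 §1.4, proof of 1.4.1). [cite: Kleiman1968, §1.4 (1.4.1)] -/
theorem isPrimitive_sub_lowerOp (hL : W.HasHardLefschetz) (hX : IsSmoothProjective n X)
    (hη : W.IsHyperplaneClass X η) {m r : ℕ} (hr : m + 2 + r = n) (h : m + 2 * 1 = m + 2)
    (y : W.obj X (m + 2)) :
    W.IsPrimitive n η (y - W.lefschetzPow X η 1 m (m + 2) h (W.lowerOp hL hX hη m r hr y)) := by
  refine ⟨fun h' ↦ absurd h' (by omega), fun r' j h' hr' ↦ ?_⟩
  obtain rfl : r' = r + 1 := by omega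
  obtain rfl : j = m + 2 * (r + 2) := by omega
  rw [map_sub, sub_eq_zero]
  simp only [lowerOp, LinearMap.coe_comp, LinearEquiv.coe_coe, Function.comp_apply]
  rw [W.lefschetzPow_lefschetzPow hX η (r := 1) (s := r + 1) (t := r + 2) (i := m) (j := m + 2)
    (m := m + 2 * (r + 2)) (by omega) h h' rfl, lefschetzPow_hardLefschetzEquiv_symm]

/-! ## The sign operator -/

/-- Kleiman's sign `(-1)^{i(i+1)/2}` attached to the primitive degree `i` in the definition of `⋆`
(Kleiman 1968 1.4.2; exact natural-number division, as in `IsLefschetzStar`). [cite: Kleiman1968, 1.4.2] -/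
def starSign (i : ℕ) : ℤˣ := ((i * (i + 1) / 2 : ℕ) : ℤ).negOnePow

/-- The **sign operator** on `Hᵃ(X)` for `a ≤ n` (`a + r = n`): the operator acting by the scalar
`(-1)^{i(i+1)/2}` on the summand `Lʲ Pⁱ(X)` (`i + 2j = a`) of the Lefschetz decomposition of
`Hᵃ(X)`. It is *defined* by two-step recursion through `Hᵐ⁺² = Pᵐ⁺² ⊕ L Hᵐ`:
the sign `(-1)^{(m+2)(m+3)/2}` on the primitive component `y - L (lowerOp y)` plus `L` of the sign
operator of `Hᵐ` applied to `lowerOp y`; `signOp_apply_lefschetzPow` shows it acts as stated.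
(Auxiliary to the construction of `⋆`, Kleiman 1968 1.4.2.) [cite: Kleiman1968, 1.4.2] -/
def signOp (hL : W.HasHardLefschetz) (hX : IsSmoothProjective n X)
    (hη : W.IsHyperplaneClass X η) : (a r : ℕ) → a + r = n → (W.obj X a →ₗ[K] W.obj X a)
  | 0, _, _ => ((starSign 0 : ℤ) : K) • LinearMap.id
  | 1, _, _ => ((starSign 1 : ℤ) : K) • LinearMap.id
  | m + 2, r, hr =>
    ((starSign (m + 2) : ℤ) : K) •
        (LinearMap.id - W.lefschetzPow X η 1 m (m + 2) (by omega) ∘ₗ W.lowerOp hL hX hη m r hr) +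
      W.lefschetzPow X η 1 m (m + 2) (by omega) ∘ₗ signOp hL hX hη m (r + 2) (by omega) ∘ₗ
        W.lowerOp hL hX hη m r hr

/-- The sign operator acts by `(-1)^{a(a+1)/2}` on primitive classes of degree `a`. [folklore] -/
theorem signOp_apply_of_isPrimitive (hL : W.HasHardLefschetz) (hX : IsSmoothProjective n X)
    (hη : W.IsHyperplaneClass X η) :
    ∀ (a r : ℕ) (hr : a + r = n) {x : W.obj X a}, W.IsPrimitive n η x →
      W.signOp hL hX hη a r hr x = ((starSign a : ℤ) : K) • x
  | 0, _, _, _, _ => by simp [signOp]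
  | 1, _, _, _, _ => by simp [signOp]
  | m + 2, r, hr, x, hx => by
    simp [signOp, W.lowerOp_apply_of_isPrimitive hL hX hη hr hx]

/-- The sign operator acts by `(-1)^{i(i+1)/2}` on `Lʲ Pⁱ(X) ⊆ Hᵃ(X)`, `i + 2j = a ≤ n`
(by induction on `j`, using `lowerOp (L z) = z`). [folklore] -/
theorem signOp_apply_lefschetzPow (hL : W.HasHardLefschetz) (hX : IsSmoothProjective n X)
    (hη : W.IsHyperplaneClass X η) :
    ∀ (j a r : ℕ) (hr : a + r = n) {i : ℕ} (h : i + 2 * j = a) {x : W.obj X i},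
      W.IsPrimitive n η x →
        W.signOp hL hX hη a r hr (W.lefschetzPow X η j i a h x) =
          ((starSign i : ℤ) : K) • W.lefschetzPow X η j i a h x := by
  intro j
  induction j with
  | zero =>
    intro a r hr i h x hx
    obtain rfl : i = a := by omega
    rw [W.lefschetzPow_zero_eq_self hX]
    exact W.signOp_apply_of_isPrimitive hL hX hη _ r hr hx
  | succ j ih =>
    intro a r hr i h x hx
    obtain ⟨m, rfl⟩ : ∃ m, a = m + 2 := ⟨a - 2, by omega⟩
    have hLx : W.lefschetzPow X η (j + 1) i (m + 2) h x =
        W.lefschetzPow X η 1 m (m + 2) (by omega) (W.lefschetzPow X η j i m (by omega) x) :=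
      (W.lefschetzPow_lefschetzPow hX η (r := j) (s := 1) (t := j + 1) rfl _ _ h x).symm
    rw [hLx, signOp]
    simp only [LinearMap.add_apply, LinearMap.smul_apply, LinearMap.sub_apply,
      LinearMap.id_apply, LinearMap.comp_apply, lowerOp_lefschetzPow_one, sub_self, smul_zero,
      zero_add]
    rw [ih m (r + 2) (by omega) (by omega) hx, LinearMap.map_smul]

/-! ## The operator `⋆` -/

/-- **Kleiman's `⋆` under hard Lefschetz** (construction, Kleiman 1968 1.4.2): on `Hᵃ(X)` with
`a ≤ n` it is `Lⁿ⁻ᵃ ∘ signOp : Hᵃ → H²ⁿ⁻ᵃ`; on `Hᵃ(X)` with `n < a ≤ 2n` it is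
`signOp ∘ (Lᵃ⁻ⁿ)⁻¹ : Hᵃ → H²ⁿ⁻ᵃ`; all components off total degree `2n` are zero. On `Lʲ x`,
`x ∈ Pⁱ(X)`, `i + j + s = n`, both formulas give `(-1)^{i(i+1)/2} Lˢ x`
(`isLefschetzStar_starOp`). [cite: Kleiman1968, 1.4.2] -/
def starOp (hL : W.HasHardLefschetz) (hX : IsSmoothProjective n X)
    (hη : W.IsHyperplaneClass X η) : W.GradedOp X X := fun a b ↦
  if hab : a + b = 2 * n then
    if ha : a ≤ n then
      W.lefschetzPow X η (n - a) a b (by omega) ∘ₗ W.signOp hL hX hη a (n - a) (by omega)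
    else
      W.signOp hL hX hη b (n - b) (by omega) ∘ₗ
        (W.hardLefschetzEquiv hL hX hη b (n - b) a (by omega) (by omega)).symm.toLinearMap
  else 0

/-- The constructed operator `starOp` **is** a Lefschetz star operator `⋆`
(existence half of Kleiman 1968 1.4.2). [cite: Kleiman1968, 1.4.2] -/
theorem isLefschetzStar_starOp (hL : W.HasHardLefschetz) (hX : IsSmoothProjective n X)
    (hη : W.IsHyperplaneClass X η) : W.IsLefschetzStar n η (W.starOp hL hX hη) := by
  refine ⟨fun a b hab ↦ dif_neg hab, fun i x hx j s a b ha hb hs ↦ ?_⟩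
  have hab : a + b = 2 * n := by omega
  simp only [starOp, dif_pos hab]
  by_cases han : a ≤ n
  · rw [dif_pos han, LinearMap.comp_apply, W.signOp_apply_lefschetzPow hL hX hη j a (n - a) _ ha hx,
      LinearMap.map_smul, W.lefschetzPow_lefschetzPow hX η (r := j) (s := n - a) (t := s)
        (by omega) ha _ hb]
    exact Int.cast_smul_eq_zsmul K _ _
  · rw [dif_neg han, LinearMap.comp_apply, LinearEquiv.coe_coe]
    have hj : W.lefschetzPow X η j i a ha x = W.hardLefschetzEquiv hL hX hη b (n - b) a
        (by omega) (by omega) (W.lefschetzPow X η s i b hb x) := by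
      rw [hardLefschetzEquiv_apply, W.lefschetzPow_lefschetzPow hX η (r := s) (s := n - b)
        (t := j) (by omega) hb _ ha]
    rw [hj, LinearEquiv.symm_apply_apply, W.signOp_apply_lefschetzPow hL hX hη s b (n - b) _ hb hx]
    exact Int.cast_smul_eq_zsmul K _ _

/-! ## Spanning by the Lefschetz summands, uniqueness -/

/-- Spanning half of the **Lefschetz decomposition** in degrees `a ≤ n` (Kleiman 1968 1.4.1): an
additive property of classes in `Hᵃ(X)` holding on all `Lʲ x`, `x ∈ Pⁱ(X)` primitive,
`i + 2j = a`, holds everywhere (two-step induction on `a` through `Hᵐ⁺² = Pᵐ⁺² ⊕ L Hᵐ`). [cite: Kleiman1968, 1.4.1] -/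
theorem lefschetz_induction_of_le (hL : W.HasHardLefschetz) (hX : IsSmoothProjective n X)
    (hη : W.IsHyperplaneClass X η) :
    ∀ (a : ℕ), a ≤ n → ∀ {C : W.obj X a → Prop}, C 0 → (∀ y z, C y → C z → C (y + z)) →
      (∀ (i j : ℕ) (h : i + 2 * j = a) (x : W.obj X i), W.IsPrimitive n η x →
        C (W.lefschetzPow X η j i a h x)) → ∀ y, C y := by
  intro a
  induction a using Nat.twoStepInduction with
  | zero =>
    intro _ C _ _ prim y
    have hy : W.IsPrimitive n η y :=
      ⟨fun h ↦ absurd h (Nat.not_lt_zero n), fun r j h hr ↦ by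
        haveI := W.subsingleton_obj hX (i := j) (by omega)
        exact Subsingleton.elim _ _⟩
    simpa only [W.lefschetzPow_zero_eq_self hX] using prim 0 0 (by omega) y hy
  | one =>
    intro hn C _ _ prim y
    have hy : W.IsPrimitive n η y :=
      ⟨fun h ↦ absurd h (by omega), fun r j h hr ↦ by
        haveI := W.subsingleton_obj hX (i := j) (by omega)
        exact Subsingleton.elim _ _⟩
    simpa only [W.lefschetzPow_zero_eq_self hX] using prim 1 0 (by omega) y hy
  | more m ih _ =>
    intro hm C zero add prim y
    obtain ⟨r, hr⟩ : ∃ r, m + 2 + r = n := ⟨n - (m + 2), by omega⟩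
    have h2m : m + 2 * 1 = m + 2 := by omega
    have h₁ : C (y - W.lefschetzPow X η 1 m (m + 2) h2m (W.lowerOp hL hX hη m r hr y)) := by
      simpa only [W.lefschetzPow_zero_eq_self hX] using
        prim (m + 2) 0 (by omega) _ (W.isPrimitive_sub_lowerOp hL hX hη hr h2m y)
    have h₂ : C (W.lefschetzPow X η 1 m (m + 2) h2m (W.lowerOp hL hX hη m r hr y)) := by
      refine ih (by omega) (C := fun z ↦ C (W.lefschetzPow X η 1 m (m + 2) h2m z)) ?_ ?_ ?_ _
      · simpa only [map_zero] using zero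
      · intro y' z' hy' hz'
        simpa only [map_add] using add _ _ hy' hz'
      · intro i j h x hx
        have h3 : i + 2 * (j + 1) = m + 2 := by omega
        simpa only [W.lefschetzPow_lefschetzPow hX η (r := j) (s := 1) (t := j + 1) rfl h h2m h3]
          using prim i (j + 1) h3 x hx
    simpa only [sub_add_cancel] using add _ _ h₁ h₂

/-- **Lefschetz spanning principle** (Kleiman 1968 1.4.1 with hard Lefschetz): an additive property
of classes in `Hᵃ(X)` (any `a`) holding on all `Lʲ x` with `x ∈ Pⁱ(X)` primitive, `i + 2j = a`
and `i + j ≤ n`, holds on all of `Hᵃ(X)`; for `n < a ≤ 2n` by transport along the hard-Lefschetz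
isomorphism `Lᵃ⁻ⁿ : H²ⁿ⁻ᵃ ≃ Hᵃ`, for `a > 2n` because `Hᵃ(X) = 0`. [cite: Kleiman1968, 1.4.1] -/
theorem lefschetz_induction (hL : W.HasHardLefschetz) (hX : IsSmoothProjective n X)
    (hη : W.IsHyperplaneClass X η) {a : ℕ} {C : W.obj X a → Prop} (zero : C 0)
    (add : ∀ y z, C y → C z → C (y + z))
    (prim : ∀ (i j : ℕ) (h : i + 2 * j = a) (x : W.obj X i), W.IsPrimitive n η x → i + j ≤ n →
      C (W.lefschetzPow X η j i a h x))
    (y : W.obj X a) : C y := by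
  by_cases ha : a ≤ n
  · exact W.lefschetz_induction_of_le hL hX hη a ha zero add
      (fun i j h x hx ↦ prim i j h x hx (by omega)) y
  by_cases h2 : a ≤ 2 * n
  · obtain ⟨b, r, hbr, hba⟩ : ∃ b r, b + r = n ∧ b + 2 * r = a :=
      ⟨2 * n - a, a - n, by omega, by omega⟩
    rw [← (W.hardLefschetzEquiv hL hX hη b r a hbr hba).apply_symm_apply y]
    refine W.lefschetz_induction_of_le hL hX hη b (by omega)
      (C := fun z ↦ C (W.hardLefschetzEquiv hL hX hη b r a hbr hba z)) ?_ ?_ ?_ _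
    · simpa only [map_zero] using zero
    · intro y' z' hy' hz'
      simpa only [map_add] using add _ _ hy' hz'
    · intro i j h x hx
      have h3 : i + 2 * (j + r) = a := by omega
      have he : W.hardLefschetzEquiv hL hX hη b r a hbr hba (W.lefschetzPow X η j i b h x) =
          W.lefschetzPow X η (j + r) i a h3 x :=
        W.lefschetzPow_lefschetzPow hX η rfl h hba h3 x
      simpa only [he] using prim i (j + r) h3 x hx (by omega)
  · haveI := W.subsingleton_obj hX (i := a) (by omega)
    rw [Subsingleton.elim y 0]
    exact zero

/-- **Uniqueness of `⋆`** (Kleiman 1968 1.4.2): two Lefschetz star operators coincide, since both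
vanish off total degree `2n` and agree on the spanning family `Lʲ Pⁱ(X)`. [cite: Kleiman1968, 1.4.2] -/
theorem isLefschetzStar_unique (hL : W.HasHardLefschetz) (hX : IsSmoothProjective n X)
    (hη : W.IsHyperplaneClass X η) {S S' : W.GradedOp X X} (hS : W.IsLefschetzStar n η S)
    (hS' : W.IsLefschetzStar n η S') : S = S' := by
  funext a b
  by_cases hab : a + b = 2 * n
  · refine LinearMap.ext fun y ↦ ?_
    refine W.lefschetz_induction hL hX hη (C := fun y ↦ S a b y = S' a b y) ?_ ?_ ?_ y
    · simp only [map_zero]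
    · intro y z hy hz
      show S a b (y + z) = S' a b (y + z)
      rw [map_add, map_add, show S a b y = S' a b y from hy, show S a b z = S' a b z from hz]
    · intro i j h x hx hij
      obtain ⟨s, hs⟩ : ∃ s, i + j + s = n := ⟨n - (i + j), by omega⟩
      have hb : i + 2 * s = b := by omega
      show S a b _ = S' a b _
      rw [hS.2 i x hx j s a b h hb hs, hS'.2 i x hx j s a b h hb hs]
  · rw [hS.1 a b hab, hS'.1 a b hab]

/-- **Existence and uniqueness of `⋆`** (Kleiman 1968 1.4.2; Kleiman 1994 §4), discharging the
named fact `existsUnique_isLefschetzStar`: under hard Lefschetz, for `X` smooth projective of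
dimension `n` and `η` a hyperplane class there is a unique graded operator `⋆` on `H•(X)` with
`⋆ (Lʲ x) = (-1)^{i(i+1)/2} Lⁿ⁻ⁱ⁻ʲ x` for `x ∈ Pⁱ(X)` primitive and vanishing off total degree `2n`.
Existence: `starOp`; uniqueness: `isLefschetzStar_unique`. [cite: Kleiman1968, 1.4.2] -/
theorem existsUnique_isLefschetzStar_holds :
    W.existsUnique_isLefschetzStar (n := n) (X := X) (η := η) := fun hL hX hη ↦
  ⟨W.starOp hL hX hη, W.isLefschetzStar_starOp hL hX hη,
    fun _ hS ↦ W.isLefschetzStar_unique hL hX hη hS (W.isLefschetzStar_starOp hL hX hη)⟩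

end WeilCohomology

end Literature.AlgebraicGeometry.Motives

end
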